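import Literature.Probability.LatticeModels.TorusFourierDecayFromDifferences
import HarnessLib

/-!
# Decay of character sums on a product of tori (space-time), and the combination of directional decay bounds

Topic `Literature/Probability/LatticeModels`; continues `TorusFourierDecayFromDifferences.lean` (one torus
`(ℤ/Lℤ)^d`).  The position-space propagators of a lattice fermion model at positive temperature are character sums
over a PRODUCT `(ℤ/L₁ℤ)^{d₁} × (ℤ/L₂ℤ)^{d₂}` — the `2M` Matsubara frequencies (dual to the `2M` imaginary-time slices,
Salmhofer 1999, §4.2.4) times the spatial dual torus — `g(z₁,z₂) = Σ_{k₁,k₂} χ_{k₁}(z₁)χ_{k₂}(z₂) • G(k₁,k₂)`, and the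
anisotropic bound of Benfatto–Giuliani–Mastropietro 2006, Lemma 2.2,
`|g| ≤ C_N γ^{3h/2}(1 + γ^h|x₀| + γ^h|x'₁| + γ^{h/2}|x'₂|)^{-N}`, is obtained by combining ONE-DIRECTIONAL decay bounds
(differences of the symbol in the time index, along the lattice axes, and along an integer approximant of the tangent
direction).  This file provides the two generic pieces:

* `sum_prodChar_smul_comp_add_fst/snd`, `sum_prodChar_smul_fwdDiff_iter_fst/snd` — differences of the symbol in one
  factor multiply the sum by `(conj χ_v(zᵢ) - 1)^N` of that factor; **`norm_sum_prodChar_smul_mul_pow_le_fst/snd`** —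
  hence `‖g(z₁,z₂)‖ (4|ã|/Lᵢ)^N ≤ Σ ‖Δ^N G‖` for the differences `Δ_{(v,0)}` / `Δ_{(0,v)}`, `ã = valMinAbs (Σⱼ vⱼ (zᵢ)ⱼ)`;
* `one_add_sum_pow_le`, **`mul_one_add_sum_pow_le`** — the combination: if `0 ≤ a ≤ S₀` and `a · bᵢ^N ≤ Sᵢ` for
  `i ∈ I` (`bᵢ ≥ 0`), then `a (1 + Σᵢ bᵢ)^N ≤ (|I| + 1)^N (S₀ + Σᵢ Sᵢ)`.

Everything is proved; no definitions, no named facts. [folklore]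

## Sources

G. Benfatto, A. Giuliani, V. Mastropietro, Ann. Henri Poincaré 7 (2006) 809–898, Lemma 2.2 and footnote ¹
(`BenfattoGiulianiMastropietro2006`); M. Salmhofer, *Renormalization* (1999), §4.2.4 (`Salmhofer1999`).
-/

noncomputable section

open Finset Complex
open scoped Real ComplexConjugate

namespace Literature.Probability.LatticeModels

/-! ### The combination of directional decay bounds -/

/-- `(1 + Σᵢ bᵢ)^N ≤ (|I|+1)^N (1 + Σᵢ bᵢ^N)` for `bᵢ ≥ 0` (comparison with the maximum). [folklore] -/
theorem one_add_sum_pow_le {ι : Type*} (I : Finset ι) (b : ι → ℝ) (hb : ∀ i ∈ I, 0 ≤ b i) (N : ℕ) :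
    (1 + ∑ i ∈ I, b i) ^ N ≤ ((I.card : ℝ) + 1) ^ N * (1 + ∑ i ∈ I, b i ^ N) := by
  classical
  -- the maximum of `1` and the `bᵢ`
  have hne : (insert (1 : ℝ) (I.image b)).Nonempty := ⟨1, mem_insert_self _ _⟩
  set m : ℝ := (insert (1 : ℝ) (I.image b)).max' hne with hm
  have h1m : 1 ≤ m := le_max' _ _ (mem_insert_self _ _)
  have hbm : ∀ i ∈ I, b i ≤ m := fun i hi => le_max' _ _ (mem_insert_of_mem (mem_image_of_mem b hi))
  -- `1 + Σ bᵢ ≤ (|I|+1) m`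
  have hsum : 1 + ∑ i ∈ I, b i ≤ ((I.card : ℝ) + 1) * m := by
    calc 1 + ∑ i ∈ I, b i ≤ m + ∑ _i ∈ I, m := add_le_add h1m (sum_le_sum hbm)
      _ = ((I.card : ℝ) + 1) * m := by rw [sum_const, nsmul_eq_mul]; ring
  -- `m^N ≤ 1 + Σ bᵢ^N`
  have hmN : m ^ N ≤ 1 + ∑ i ∈ I, b i ^ N := by
    have hmem : m ∈ insert (1 : ℝ) (I.image b) := max'_mem _ _
    rcases mem_insert.1 hmem with h | h
    · rw [h, one_pow]; exact le_add_of_nonneg_right (sum_nonneg fun i hi => pow_nonneg (hb i hi) _)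
    · obtain ⟨i, hi, hbi⟩ := mem_image.1 h
      rw [← hbi]
      exact le_add_of_nonneg_of_le zero_le_one (single_le_sum (f := fun i => b i ^ N) (fun j hj => pow_nonneg (hb j hj) _) hi)
  have h0 : 0 ≤ 1 + ∑ i ∈ I, b i := by linarith [sum_nonneg hb]
  calc (1 + ∑ i ∈ I, b i) ^ N ≤ (((I.card : ℝ) + 1) * m) ^ N := pow_le_pow_left₀ h0 hsum N
    _ = ((I.card : ℝ) + 1) ^ N * m ^ N := mul_pow _ _ _
    _ ≤ ((I.card : ℝ) + 1) ^ N * (1 + ∑ i ∈ I, b i ^ N) := mul_le_mul_of_nonneg_left hmN (by positivity)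

/-- **Combining directional decay bounds**: if `0 ≤ a ≤ S₀` and `a · bᵢ^N ≤ Sᵢ` with `bᵢ ≥ 0` for `i ∈ I`, then
`a (1 + Σᵢ bᵢ)^N ≤ (|I|+1)^N (S₀ + Σᵢ Sᵢ)`. [folklore] -/
theorem mul_one_add_sum_pow_le {ι : Type*} (I : Finset ι) (N : ℕ) {a : ℝ} (ha : 0 ≤ a) (b S : ι → ℝ) {S₀ : ℝ}
    (haS : a ≤ S₀) (hb : ∀ i ∈ I, 0 ≤ b i) (hS : ∀ i ∈ I, a * b i ^ N ≤ S i) :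
    a * (1 + ∑ i ∈ I, b i) ^ N ≤ ((I.card : ℝ) + 1) ^ N * (S₀ + ∑ i ∈ I, S i) := by
  calc a * (1 + ∑ i ∈ I, b i) ^ N ≤ a * (((I.card : ℝ) + 1) ^ N * (1 + ∑ i ∈ I, b i ^ N)) :=
        mul_le_mul_of_nonneg_left (one_add_sum_pow_le I b hb N) ha
    _ = ((I.card : ℝ) + 1) ^ N * (a * (1 + ∑ i ∈ I, b i ^ N)) := by ring
    _ = ((I.card : ℝ) + 1) ^ N * (a + ∑ i ∈ I, a * b i ^ N) := by rw [mul_add, mul_one, mul_sum]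
    _ ≤ ((I.card : ℝ) + 1) ^ N * (S₀ + ∑ i ∈ I, S i) :=
        mul_le_mul_of_nonneg_left (add_le_add haS (sum_le_sum hS)) (by positivity)

/-! ### Character sums on a product of tori -/

section Product

variable {d₁ d₂ L₁ L₂ : ℕ} [NeZero L₁] [NeZero L₂] {E : Type*} [NormedAddCommGroup E] [NormedSpace ℂ E]

/-- **Shifting the symbol in the first factor**:
`Σ_p χ_{p₁}(z₁)χ_{p₂}(z₂) • G(p + (v,0)) = conj χ_v(z₁) • Σ_p χ_{p₁}(z₁)χ_{p₂}(z₂) • G(p)`. [folklore] -/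
theorem sum_prodChar_smul_comp_add_fst (G : TorusSite d₁ L₁ × TorusSite d₂ L₂ → E) (v z₁ : TorusSite d₁ L₁) (z₂ : TorusSite d₂ L₂) :
    ∑ p, (torusChar p.1 z₁ * torusChar p.2 z₂) • G (p + (v, 0)) =
      conj (torusChar v z₁) • ∑ p, (torusChar p.1 z₁ * torusChar p.2 z₂) • G p := by
  rw [Finset.smul_sum]
  conv_rhs => rw [← Equiv.sum_comp (Equiv.addRight (v, (0 : TorusSite d₂ L₂)))]
  refine sum_congr rfl fun p _ => ?_
  simp only [Equiv.coe_addRight, Prod.fst_add, Prod.snd_add, add_zero, torusChar_add_left, smul_smul]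
  congr 1
  linear_combination -(torusChar p.1 z₁ * torusChar p.2 z₂) * torusChar_mul_conj v z₁

/-- **Shifting the symbol in the second factor.** [folklore] -/
theorem sum_prodChar_smul_comp_add_snd (G : TorusSite d₁ L₁ × TorusSite d₂ L₂ → E) (z₁ : TorusSite d₁ L₁) (v z₂ : TorusSite d₂ L₂) :
    ∑ p, (torusChar p.1 z₁ * torusChar p.2 z₂) • G (p + (0, v)) =
      conj (torusChar v z₂) • ∑ p, (torusChar p.1 z₁ * torusChar p.2 z₂) • G p := by
  rw [Finset.smul_sum]
  conv_rhs => rw [← Equiv.sum_comp (Equiv.addRight ((0 : TorusSite d₁ L₁), v))]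
  refine sum_congr rfl fun p _ => ?_
  simp only [Equiv.coe_addRight, Prod.fst_add, Prod.snd_add, add_zero, torusChar_add_left, smul_smul]
  congr 1
  linear_combination -(torusChar p.1 z₁ * torusChar p.2 z₂) * torusChar_mul_conj v z₂

/-- **Iterated differences in the first factor**: `Σ_p χχ • (Δ_{(v,0)}^N G)(p) = (conj χ_v(z₁) - 1)^N • g(z₁,z₂)`. [folklore] -/
theorem sum_prodChar_smul_fwdDiff_iter_fst (v z₁ : TorusSite d₁ L₁) (z₂ : TorusSite d₂ L₂) :
    ∀ (N : ℕ) (G : TorusSite d₁ L₁ × TorusSite d₂ L₂ → E),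
      ∑ p, (torusChar p.1 z₁ * torusChar p.2 z₂) • ((fwdDiff (v, (0 : TorusSite d₂ L₂)))^[N] G) p =
        (conj (torusChar v z₁) - 1) ^ N • ∑ p, (torusChar p.1 z₁ * torusChar p.2 z₂) • G p
  | 0, G => by simp
  | N + 1, G => by
    rw [Function.iterate_succ_apply, sum_prodChar_smul_fwdDiff_iter_fst v z₁ z₂ N (fwdDiff (v, 0) G), pow_succ, ← smul_smul]
    congr 1
    simp only [fwdDiff, smul_sub, Finset.sum_sub_distrib, sum_prodChar_smul_comp_add_fst, sub_smul, one_smul]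

/-- **Iterated differences in the second factor.** [folklore] -/
theorem sum_prodChar_smul_fwdDiff_iter_snd (z₁ : TorusSite d₁ L₁) (v z₂ : TorusSite d₂ L₂) :
    ∀ (N : ℕ) (G : TorusSite d₁ L₁ × TorusSite d₂ L₂ → E),
      ∑ p, (torusChar p.1 z₁ * torusChar p.2 z₂) • ((fwdDiff ((0 : TorusSite d₁ L₁), v))^[N] G) p =
        (conj (torusChar v z₂) - 1) ^ N • ∑ p, (torusChar p.1 z₁ * torusChar p.2 z₂) • G p
  | 0, G => by simp
  | N + 1, G => by
    rw [Function.iterate_succ_apply, sum_prodChar_smul_fwdDiff_iter_snd z₁ v z₂ N (fwdDiff (0, v) G), pow_succ, ← smul_smul]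
    congr 1
    simp only [fwdDiff, smul_sub, Finset.sum_sub_distrib, sum_prodChar_smul_comp_add_snd, sub_smul, one_smul]

/-- Norm bookkeeping common to both factors. [folklore] -/
theorem norm_sum_prodChar_smul_mul_pow_le_of_eq (G : TorusSite d₁ L₁ × TorusSite d₂ L₂ → E) (z₁ : TorusSite d₁ L₁)
    (z₂ : TorusSite d₂ L₂) {c : ℂ} {r : ℝ} (hr : 0 ≤ r) (hrc : r ≤ ‖c - 1‖) (N : ℕ) (H : TorusSite d₁ L₁ × TorusSite d₂ L₂ → E)
    (hH : ∑ p, (torusChar p.1 z₁ * torusChar p.2 z₂) • H p = (conj c - 1) ^ N • ∑ p, (torusChar p.1 z₁ * torusChar p.2 z₂) • G p) :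
    ‖∑ p, (torusChar p.1 z₁ * torusChar p.2 z₂) • G p‖ * r ^ N ≤ ∑ p, ‖H p‖ := by
  have hconj : ‖conj c - 1‖ = ‖c - 1‖ := by
    rw [show conj c - 1 = conj (c - 1) by rw [map_sub, map_one], Complex.norm_conj]
  calc ‖∑ p, (torusChar p.1 z₁ * torusChar p.2 z₂) • G p‖ * r ^ N
      ≤ ‖∑ p, (torusChar p.1 z₁ * torusChar p.2 z₂) • G p‖ * ‖c - 1‖ ^ N :=
        mul_le_mul_of_nonneg_left (pow_le_pow_left₀ hr hrc N) (norm_nonneg _)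
    _ = ‖∑ p, (torusChar p.1 z₁ * torusChar p.2 z₂) • H p‖ := by rw [hH, norm_smul, norm_pow, hconj, mul_comm]
    _ ≤ ∑ p, ‖H p‖ := (norm_sum_le _ _).trans (le_of_eq (sum_congr rfl fun p _ => by
        rw [norm_smul, norm_mul, norm_torusChar, norm_torusChar, one_mul, one_mul]))

/-- **Decay in the first factor from differences of the symbol** (discrete integration by parts on the product
torus): `‖g(z₁,z₂)‖ · (4|ã|/L₁)^N ≤ Σ_p ‖(Δ_{(v,0)}^N G)(p)‖`, `ã = valMinAbs (Σⱼ vⱼ (z₁)ⱼ)`.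
[cite: BenfattoGiulianiMastropietro2006, Lemma 2.2 and (2.36aa)] -/
theorem norm_sum_prodChar_smul_mul_pow_le_fst (G : TorusSite d₁ L₁ × TorusSite d₂ L₂ → E) (v z₁ : TorusSite d₁ L₁)
    (z₂ : TorusSite d₂ L₂) (N : ℕ) :
    ‖∑ p, (torusChar p.1 z₁ * torusChar p.2 z₂) • G p‖ * (4 * |((∑ j, v j * z₁ j).valMinAbs : ℝ)| / L₁) ^ N ≤
      ∑ p, ‖((fwdDiff (v, (0 : TorusSite d₂ L₂)))^[N] G) p‖ :=
  norm_sum_prodChar_smul_mul_pow_le_of_eq G z₁ z₂ (by positivity) (le_norm_torusChar_sub_one v z₁) N _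
    (sum_prodChar_smul_fwdDiff_iter_fst v z₁ z₂ N G)

/-- **Decay in the second factor from differences of the symbol**: `‖g(z₁,z₂)‖ · (4|ã|/L₂)^N ≤ Σ_p ‖(Δ_{(0,v)}^N G)(p)‖`,
`ã = valMinAbs (Σⱼ vⱼ (z₂)ⱼ)`. [cite: BenfattoGiulianiMastropietro2006, Lemma 2.2 and (2.36aa)] -/
theorem norm_sum_prodChar_smul_mul_pow_le_snd (G : TorusSite d₁ L₁ × TorusSite d₂ L₂ → E) (z₁ : TorusSite d₁ L₁)
    (v z₂ : TorusSite d₂ L₂) (N : ℕ) :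
    ‖∑ p, (torusChar p.1 z₁ * torusChar p.2 z₂) • G p‖ * (4 * |((∑ j, v j * z₂ j).valMinAbs : ℝ)| / L₂) ^ N ≤
      ∑ p, ‖((fwdDiff ((0 : TorusSite d₁ L₁), v))^[N] G) p‖ :=
  norm_sum_prodChar_smul_mul_pow_le_of_eq G z₁ z₂ (by positivity) (le_norm_torusChar_sub_one v z₂) N _
    (sum_prodChar_smul_fwdDiff_iter_snd z₁ v z₂ N G)

end Product

end Literature.Probability.LatticeModels
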